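import Summits.ResolutionOfSingularities.ResolutionOfSingularities.Theorems.ShallowPort3

/-!
# ShallowPort4 — stage zero, part 1: field-theoretic lemmas and Cossart–Piltant's frame record (§9a)

* `locAtCentre_eq_of_fractions` (a dominated ring of fractions of `B` is `locAtCentre B O`), `ker_aeval_mapRingHom_eq_span`
  (kernel of the root map is `(h₀)` by (MIN)), `ker_lift_eq_map_ker`, `irreducible_X_pow_add_C_of_forall_ne_pow` (`Z^p + F`
  irreducible over the fraction field of an integrally closed domain of characteristic `p` when `F` is not a `p`-th power).
* `ZeroFrame T p` — the record of Cossart–Piltant's frame at stage `0` (Thm. 1.5 data: `R`, `h`, `x`, (MIN), (GEN), case (i))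
  together with the facts placing `φ₀(𝒪_{X_0,x_0})` as `R[x]_{(x,u)}`.

References: CP 2019 Thm. 1.5, Def. 2.3 [CossartPiltant2019]; Cutkosky 2004 §2.1. AI-written; weaker than expert review.
(decomp-res lens-5 g38, critic ROW 232 (M-Shallow); host route `MaxContactCut`, item stmt-ResolutionOfSingularities-31768 `PolyPureTowersShallow`;
source of truth: the farm-checked monolith `ShallowPortNode.lean`, of which this is land slice 4/6 — slices land sequentially, slice k imports slice k-1.)
-/

noncomputable section

set_option linter.dupNamespace false

open IsLocalRing IsLocalization
open Literature.RingTheory.HilbertSamuel Literature.AlgebraicGeometry.Resolution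
open Summit.ResolutionOfSingularities.ResolutionOfSingularities.Theorems.SigmaMaxModificationsCorridor3.Helpers
open Summit.ResolutionOfSingularities.ResolutionOfSingularities.Theorems.SwitchingDichotomy.SteeredRun

universe u

namespace Summit.ResolutionOfSingularities.ResolutionOfSingularities.Theorems.ShallowPort

/-! ## §9 Stage zero: Cossart–Piltant's frame at the root `(𝔸⁴_k, (Z^p + F), p)` -/

section StageZero

open CategoryTheory AlgebraicGeometry TopologicalSpace Topology Polynomial
open Scheme.IdealSheafData
open Summit.ResolutionOfSingularities.ResolutionOfSingularities.Theorems.ForcedTowerClasses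
open Summit.ResolutionOfSingularities.ResolutionOfSingularities.Theorems.HugValuationCut
open Summit.ResolutionOfSingularities.ResolutionOfSingularities.Theorems.TightDefectClasses

/-- **A local ring of `B` is `(B)_{𝔪_O ∩ B}` for every dominating valuation ring `O`** (re-proved from the tree's
`IdeasL1C5.locAtCentre_eq_of_isLocalRingOf` to keep the import cone small): if `B ≤ S ⊆ L` and every element of `S` is `y / z`
with `y, z ∈ B`, `z⁻¹ ∈ S`, then `S = locAtCentre B O` whenever `O` dominates `S`. [cite: Cutkosky2014, §2.1] -/
theorem locAtCentre_eq_of_fractions {L : Type} [Field L] {B S : Subring L} (hBS : B ≤ S)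
    (hfrac : ∀ w ∈ S, ∃ y ∈ B, ∃ z ∈ B, z⁻¹ ∈ S ∧ w = y / z)
    (O : ValuationSubring L) (hdom : SubringDominates S O.toSubring) : S = locAtCentre B O := by
  have hSO : S ≤ O.toSubring := hdom.1
  apply le_antisymm
  · intro w hw
    obtain ⟨y, hy, z, hz, hzinv, rfl⟩ := hfrac w hw
    by_cases hz0 : z = 0
    · subst hz0
      exact ⟨0, B.zero_mem, 1, B.one_mem, by simp, by simp⟩
    · have h1 : O.valuation z ≤ 1 := (O.valuation_le_one_iff _).mpr (hSO (hBS hz))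
      have h2 : O.valuation z⁻¹ ≤ 1 := (O.valuation_le_one_iff _).mpr (hSO hzinv)
      rw [map_inv₀, inv_le_one₀ ((Valuation.pos_iff _).mpr hz0)] at h2
      exact ⟨y, hy, z, hz, le_antisymm h1 h2, rfl⟩
  · rintro _ ⟨y, hy, z, hz, hvz, rfl⟩
    have hzinvO : z⁻¹ ∈ O.toSubring := by
      change z⁻¹ ∈ O
      rw [← O.valuation_le_one_iff, map_inv₀, hvz, inv_one]
    have hzinv : z⁻¹ ∈ S := hdom.2 z (hBS hz) hzinvO
    rw [div_eq_mul_inv]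
    exact S.mul_mem (hBS hy) hzinv

/-- **The kernel of the root map `P[Z] → L`, `Z ↦ x`**, for a monic `h₀ ∈ P[Z]` irreducible over the fraction field of the
domain `S ⊇ P` and a root `x` of `h₀` in a field `L ⊇ S`: it is `(h₀)` (divide by the monic `h₀`; the remainder has degree
`< deg h₀` and kills `x`, so vanishes by minimality (MIN)). [cite: CossartPiltant2019, Thm. 1.5 (MIN)] -/
theorem ker_aeval_mapRingHom_eq_span {P S K L : Type} [CommRing P] [CommRing S] [IsDomain S] [Field K] [Field L]
    [Algebra P S] [Algebra S K] [IsFractionRing S K] [Algebra K L] [Algebra S L] [IsScalarTower S K L]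
    (hPS : Function.Injective (algebraMap P S)) {h₀ : P[X]} (hmon : h₀.Monic) (h1 : h₀ ≠ 1)
    (hirr : Irreducible ((h₀.map (algebraMap P S)).map (algebraMap S K))) {x : L}
    (hx : aeval x (h₀.map (algebraMap P S)) = 0) :
    RingHom.ker ((Polynomial.aeval x).toRingHom.comp (mapRingHom (algebraMap P S))) = Ideal.span {h₀} := by
  ext g
  rw [RingHom.mem_ker, Ideal.mem_span_singleton]
  change aeval x (g.map (algebraMap P S)) = 0 ↔ h₀ ∣ g
  constructor
  · intro hg
    have hdiv := modByMonic_add_div g h₀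
    have hr0 : aeval x ((g %ₘ h₀).map (algebraMap P S)) = 0 := by
      rw [← hdiv, Polynomial.map_add, Polynomial.map_mul, map_add, map_mul, hx, zero_mul, add_zero] at hg
      exact hg
    have hdeg : ((g %ₘ h₀).map (algebraMap P S)).natDegree < (h₀.map (algebraMap P S)).natDegree := by
      rw [hmon.natDegree_map]
      exact lt_of_le_of_lt natDegree_map_le (natDegree_modByMonic_lt g hmon h1)
    have hrS : (g %ₘ h₀).map (algebraMap P S) = 0 :=
      eq_zero_of_natDegree_lt_of_irreducible (K := K) (hmon.map _) hirr hx hdeg hr0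
    have hr' : g %ₘ h₀ = 0 := Polynomial.map_injective _ hPS (by rw [hrS, Polynomial.map_zero])
    rw [hr', zero_add] at hdiv
    exact ⟨_, hdiv.symm⟩
  · rintro ⟨c, rfl⟩
    rw [Polynomial.map_mul, map_mul, hx, zero_mul]

/-- **The kernel of the localised map**: for `ψ : Γ → L` inverting the submonoid `M`, the kernel of the induced map
`M⁻¹Γ → L` is the extension of `ker ψ`. [folklore] -/
theorem ker_lift_eq_map_ker {Γ : Type*} [CommRing Γ] {M : Submonoid Γ} {O : Type*} [CommRing O] [Algebra Γ O]
    [IsLocalization M O] {L : Type*} [CommRing L] {ψ : Γ →+* L} (hu : ∀ s : M, IsUnit (ψ s)) :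
    RingHom.ker (IsLocalization.lift hu) = (RingHom.ker ψ).map (algebraMap Γ O) := by
  apply le_antisymm
  · intro z hz
    obtain ⟨⟨a, s⟩, rfl⟩ := IsLocalization.mk'_surjective M z
    change IsLocalization.mk' O a s ∈ _
    have hz' : IsLocalization.lift hu (IsLocalization.mk' O a s) = 0 := hz
    rw [IsLocalization.lift_mk'_spec, mul_zero] at hz'
    rw [IsLocalization.mk'_eq_mul_mk'_one]
    exact Ideal.mul_mem_right _ _ (Ideal.mem_map_of_mem _ (by rwa [RingHom.mem_ker]))
  · rw [Ideal.map_le_iff_le_comap]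
    intro a ha
    rw [Ideal.mem_comap, RingHom.mem_ker, IsLocalization.lift_eq]
    exact ha

/-- **`Z^p + F` is irreducible over the fraction field when `F` is not a `p`-th power** (`P` an integrally closed domain
of characteristic `p`: a root `b` of `b^p = -F` in the fraction field is integral, hence in `P`, and `F = (-b)^p`).
[cite: CossartPiltant2019, Thm. 1.5 case (i)] -/
theorem irreducible_X_pow_add_C_of_forall_ne_pow {P K : Type} [CommRing P] [IsDomain P] [IsIntegrallyClosed P] {p : ℕ}
    [CharP P p] (hp : p.Prime) [Field K] [Algebra P K] [IsFractionRing P K] {F : P} (hF : ∀ G : P, F ≠ G ^ p) :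
    Irreducible (X ^ p + C (algebraMap P K F) : K[X]) := by
  haveI := Fact.mk hp
  have heq : (X ^ p + C (algebraMap P K F) : K[X]) = X ^ p - C (-(algebraMap P K F)) := by
    rw [map_neg, sub_neg_eq_add]
  rw [heq, X_pow_sub_C_irreducible_iff_of_prime hp]
  intro b hb
  have hint : IsIntegral P (b ^ p) := by
    rw [hb, ← map_neg]
    exact isIntegral_algebraMap
  obtain ⟨G, hG⟩ := IsIntegrallyClosed.exists_algebraMap_eq_of_isIntegral_pow hp.pos hint
  apply hF (-G)
  apply IsFractionRing.injective P K
  rw [neg_pow, neg_one_pow_char, neg_one_mul, map_neg, map_pow, hG, hb, neg_neg]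

/-- **Cossart–Piltant's frame at stage `0` of a rooted forced tower** (`Z^p + F`, `F ∈ k[u₁,u₂,u₃]` not a `p`-th power):
a field `L = K[Z]/(Z^p + F)` (`K = k(u)`), the stalk map `φ₀ : 𝒪_{X_0,x_0} → L` killing exactly `(Z^p + F)·𝒪`, the regular
local ring `R ≅ k[u]_𝔫 ⊆ L` of dimension three (excellent, residue characteristic `p`) with the purely inseparable equation
`h = Z^p + F ∈ R[Z]`, `h(x) = 0` satisfying (MIN), (GEN) and case (i), and the facts placing `φ₀(𝒪_{X_0,x_0})` as the local
ring `R[x]_{(x,u)}` of Cossart–Piltant's origin.  DEFINITION (support). [cite: CossartPiltant2019, Thm. 1.5, Def. 2.3] -/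
structure ZeroFrame (T : ForcedTower) (p : ℕ) : Type 1 where
  /-- the field `L = k(u)[Z]/(Z^p + F)` -/
  L : Type
  /-- it is a field -/
  [instField : Field L]
  /-- the stage-`0` map -/
  S₀ : Stage T L 0
  /-- Cossart–Piltant's `R` -/
  R : Subring L
  /-- `R` is regular local -/
  [instReg : IsRegularLocalRing R]
  /-- `R` is excellent -/
  hexc : IsExcellentRing R
  /-- `dim R = 3` -/
  hdim : ringKrullDim R = 3
  /-- residue characteristic `p` -/
  hchar : CharP (ResidueField R) p
  /-- the equation `h = Z^p + F` -/
  h : R[X]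
  /-- its root -/
  x : L
  /-- `h` is monic -/
  hmon : h.Monic
  /-- of degree `p` -/
  hdeg : h.natDegree = p
  /-- `h(x) = 0` -/
  hx : aeval x h = 0
  /-- (MIN) -/
  hmin : ∀ g : R[X], g.natDegree < p → aeval x g = 0 → g = 0
  /-- (GEN) -/
  hgen : ∀ z : L, ∃ (g : R[X]) (s : R), s ≠ 0 ∧ z * s = aeval x g
  /-- case (i): purely inseparable -/
  hcase : CharP L p ∧ ∀ i, 0 < i → i < p → h.coeff i = 0
  /-- `R ⊆ φ₀(𝒪)` -/
  hRB : R ≤ S₀.φ.range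
  /-- `φ₀(𝒪)` dominates `R` -/
  inv_not_mem : ∀ r : R, r ∈ maximalIdeal R → (r : L) ≠ 0 → (r : L)⁻¹ ∉ S₀.φ.range
  /-- `R[x] ⊆ φ₀(𝒪)` -/
  hBx : (Algebra.adjoin R ({x} : Set L)).toSubring ≤ S₀.φ.range
  /-- `φ₀(𝒪)` is a ring of fractions `y/z`, `y, z ∈ R[x]` -/
  hfrac : ∀ w ∈ S₀.φ.range, ∃ y ∈ (Algebra.adjoin R ({x} : Set L)).toSubring,
    ∃ z ∈ (Algebra.adjoin R ({x} : Set L)).toSubring, z⁻¹ ∈ S₀.φ.range ∧ w = y / z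

end StageZero

end Summit.ResolutionOfSingularities.ResolutionOfSingularities.Theorems.ShallowPort
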